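import Summits.ResolutionOfSingularities.ResolutionOfSingularities.Theses.WildCones
import Summits.ResolutionOfSingularities.ResolutionOfSingularities.Theorems.WildConesNarrowRunsDieStubDict
import Summits.ResolutionOfSingularities.ResolutionOfSingularities.Theorems.WildConesNarrowRunsDieStubSlice
import Summits.ResolutionOfSingularities.ResolutionOfSingularities.Theorems.WildConesNarrowRunsDieStubHomogNear
import Summits.ResolutionOfSingularities.ResolutionOfSingularities.Theorems.WildConesNarrowRunsDieStubHomogTrans
import Summits.ResolutionOfSingularities.ResolutionOfSingularities.Theorems.WildConesNarrowRunsDieStubCoset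
import Summits.ResolutionOfSingularities.ResolutionOfSingularities.Theorems.WildConesNarrowRunsDieStubPartialsDivisible
import Summits.ResolutionOfSingularities.ResolutionOfSingularities.Theorems.WildConesNarrowRunsDieStubFreeEndgame
import HarnessLib

/-!
# `NarrowRunsDie` (crux stmt-ResolutionOfSingularities-16882, route `WildCones`) — PROVED

Route `ResolutionOfSingularities/WildCones`, crux #2: for `p` an odd prime, `n ≥ 3` and `κ` perfect of
characteristic `p`, no run of the inlined point-blow-up calculus of a height-one atom
`z^p = a(u_1, …, u_n)` (`step = clean ∘ tr ∘ dv ∘ bl`, iterated along a chart word `i` and a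
translation word `t`) has ALL states isolated of multiplicity `p` (`Isol ∧ MultP`) AND all states of
cleaned order exactly `p` with one-dimensional cone-invariance space (`OrdP ∧ dL = 1`).

This file assembles the line `derivlift` (derivation lift + Frobenius coset; `Cruxes/NarrowRunsDie/
Lines/derivlift.lean`, lead's reshape v3) from its seven landed stubs
(`Theorems/WildConesNarrowRunsDieStub{Dict,Slice,HomogNear,HomogTrans,Coset,PartialsDivisible,
FreeEndgame}.lean`, all in namespace `…Theorems.NarrowRunsDie`):

1. `nrd_nearInvariant` — near directions are invariance directions: if a multiplicity-`p` state `c`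
   has a multiplicity-`p` successor `step i τ c`, the centre direction `v = e_i + Σ τ_j e_j` lies in
   `Linv c` (dictionary `stub_dict` ⇒ slice `stub_slice` ⇒ algebra `stub_homogNear`).
2. `nrd_transversal` — the next invariance space meets the new exceptional hyperplane only in `0`
   when `dL c = 1` (slice + `stub_homogTrans` + a `finrank = 1` argument).
3. `nrd_narrowIsFree` — hence every narrow run is FREE (`i (m+1) = i m ∨ t (m+1) (i m) ≠ 0`; this is
   the birth line's `stub_narrowIsFree` verbatim, so both lines' freeness node is closed).
4. `NarrowRunsDie_proof` — Frobenius coset `Φ_m(a₀) = π_m^p a_m + b^p` (`stub_coset`), derivation lift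
   `π_m Φ_m(∂_l a₀) ∈ (π_m^p)` (`stub_partialsDivisible`), and the free endgame at the finite stage
   `m = D + 1` (`stub_freeEndgame`) contradict `Isol (run 0)`.

Hypotheses used: `MultP` at all stages, `dL = 1` at all stages, `Isol` at stage `0` only; `OrdP`,
`p ≠ 2`, `3 ≤ n` are not used (cf. `Cruxes/NarrowRunsDie/Disproof.lean`: `Isol` is load-bearing —
`Negative/FalseWithoutIsol.lean` — and there is no uniform bound — `Negative/NoUniformBound.lean`;
the endgame bound `D + 2` depends on the start state, as it must).
-/

noncomputable section

-- single-problem summit: the doubled namespace component `ResolutionOfSingularities` is forced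
set_option linter.dupNamespace false

open Summit.ResolutionOfSingularities.ResolutionOfSingularities.Theses.WildCones (NarrowRunsDie)
open Summit.ResolutionOfSingularities.ResolutionOfSingularities.Theorems.NarrowRunsDie
  (stub_dict stub_slice stub_homogNear stub_homogTrans stub_coset stub_partialsDivisible stub_freeEndgame)

namespace Summit.ResolutionOfSingularities.ResolutionOfSingularities.Theorems

section ConeLemmas

open MvPolynomial

variable {κ : Type} [Field κ]

/-- Coefficients of the route's `cone` sum: the coefficient of `u^A` is `f A` if `|A| = p`, else `0`. -/
theorem nrd_coeff_coneSum (p n : ℕ) (f : (Fin n → ℕ) → κ) (A : Fin n →₀ ℕ) :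
    MvPolynomial.coeff A (Finset.sum (Fintype.piFinset (fun _ : Fin n => Finset.range (p + 1)))
      (fun B => @ite (MvPolynomial (Fin n) κ) (Finset.sum Finset.univ (fun j => B j) = p) (Classical.dec _)
        (MvPolynomial.monomial (Finsupp.equivFunOnFinite.symm B) (f B)) 0)) =
      if Finset.sum Finset.univ (fun j => A j) = p then f ⇑A else 0 := by
  classical
  rw [MvPolynomial.coeff_sum]
  have key : ∀ B ∈ Fintype.piFinset (fun _ : Fin n => Finset.range (p + 1)),
      MvPolynomial.coeff A (@ite (MvPolynomial (Fin n) κ) (Finset.sum Finset.univ (fun j => B j) = p)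
        (Classical.dec _) (MvPolynomial.monomial (Finsupp.equivFunOnFinite.symm B) (f B)) 0) =
      if B = ⇑A then (if Finset.sum Finset.univ (fun j => A j) = p then f ⇑A else 0) else 0 := by
    intro B _
    by_cases hB : B = ⇑A
    · subst hB
      rw [if_pos rfl]
      by_cases hs : Finset.sum Finset.univ (fun j => A j) = p
      · rw [if_pos hs, if_pos hs, MvPolynomial.coeff_monomial, if_pos (by simp)]
      · rw [if_neg hs, if_neg hs, MvPolynomial.coeff_zero]
    · rw [if_neg hB]
      by_cases hs : Finset.sum Finset.univ (fun j => B j) = p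
      · rw [if_pos hs, MvPolynomial.coeff_monomial, if_neg]
        intro h
        apply hB
        rw [← h]
        simp
      · rw [if_neg hs, MvPolynomial.coeff_zero]
  rw [Finset.sum_congr rfl key, Finset.sum_ite_eq']
  split_ifs with hmem hs
  · rfl
  · rfl
  · exfalso
    apply hmem
    rw [Fintype.mem_piFinset]
    intro j
    rw [Finset.mem_range]
    have : A j ≤ Finset.sum Finset.univ (fun j => A j) :=
      Finset.single_le_sum (f := fun j => A j) (fun _ _ => Nat.zero_le _) (Finset.mem_univ j)
    omega
  · rfl

/-- The route's `cone` sum is a form of degree `p`. -/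
theorem nrd_isHomogeneous_coneSum (p n : ℕ) (f : (Fin n → ℕ) → κ) :
    (Finset.sum (Fintype.piFinset (fun _ : Fin n => Finset.range (p + 1)))
      (fun B => @ite (MvPolynomial (Fin n) κ) (Finset.sum Finset.univ (fun j => B j) = p) (Classical.dec _)
        (MvPolynomial.monomial (Finsupp.equivFunOnFinite.symm B) (f B)) 0)).IsHomogeneous p := by
  classical
  rw [MvPolynomial.IsHomogeneous]
  -- degree-`p` support: read it off `nrd_coeff_coneSum`
  intro d hd
  have h := nrd_coeff_coneSum p n f d
  rw [h] at hd
  split_ifs at hd with hs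
  · rw [← hs, Finsupp.weight_apply, Finsupp.sum_fintype]
    · simp
    · simp
  · exact absurd rfl hd

end ConeLemmas

/-- **Near directions are invariance directions** (one blow-up): if a state `c` of multiplicity `p`
has a successor `step i τ c` again of multiplicity `p`, then the centre direction
`v = e_i + Σ_(j ≠ i) τ_j e_j` lies in the cone-invariance set `Linv c`. Stated over the route's `let`
calculus verbatim, for every prime `p` and every `n ≥ 1`. [cite: CossartJannsenSaito2020, Thm. 2.14] -/
theorem nrd_nearInvariant :
  ∀ p : ℕ, p.Prime → ∀ n : ℕ, 0 < n → ∀ (κ : Type) [Field κ] [CharP κ p] [PerfectField κ]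
    (c : (Fin n → ℕ) → κ) (i : Fin n) (τ : Fin n → κ),
    let clean : ((Fin n → ℕ) → κ) → ((Fin n → ℕ) → κ) := fun c A => @ite κ (∀ j, p ∣ A j) (Classical.dec _) 0 (c A);
    let bl : Fin n → ((Fin n → ℕ) → κ) → ((Fin n → ℕ) → κ) := fun i c B => @ite κ (Finset.sum (Finset.univ.erase i) (fun j => B j) ≤ B i) (Classical.dec _) (c (Function.update B i (B i - Finset.sum (Finset.univ.erase i) (fun j => B j)))) 0;
    let ord : ((Fin n → ℕ) → κ) → ℕ := fun c => sInf {m : ℕ | ∃ A, c A ≠ 0 ∧ m = Finset.sum Finset.univ (fun j => A j)};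
    let dv : Fin n → ℕ → ((Fin n → ℕ) → κ) → ((Fin n → ℕ) → κ) := fun i s c B => c (Function.update B i (B i + s));
    let tr : Fin n → (Fin n → κ) → ℕ → ((Fin n → ℕ) → κ) → ((Fin n → ℕ) → κ) := fun i τ s c B => Finset.sum (Fintype.piFinset (fun _ : Fin n => Finset.range (B i + s + 1))) (fun D => @ite κ (D i = 0) (Classical.dec _) (c (B + D) * Finset.prod (Finset.univ.erase i) (fun j => ((Nat.choose (B j + D j) (B j) : ℕ) : κ) * τ j ^ (D j))) 0);
    let step : Fin n → (Fin n → κ) → ((Fin n → ℕ) → κ) → ((Fin n → ℕ) → κ) := fun i τ c => clean (tr i τ (@ite ℕ (p ≤ ord (clean c)) (Classical.dec _) p 0) (dv i (@ite ℕ (p ≤ ord (clean c)) (Classical.dec _) p 0) (bl i (clean c))));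
    let MultP : ((Fin n → ℕ) → κ) → Prop := fun c => (∃ A, clean c A ≠ 0) ∧ ∀ A, clean c A ≠ 0 → p ≤ Finset.sum Finset.univ (fun j => A j);
    let cone : ((Fin n → ℕ) → κ) → MvPolynomial (Fin n) κ := fun c => Finset.sum (Fintype.piFinset (fun _ : Fin n => Finset.range (p + 1))) (fun A => @ite (MvPolynomial (Fin n) κ) (Finset.sum Finset.univ (fun j => A j) = p) (Classical.dec _) (MvPolynomial.monomial (Finsupp.equivFunOnFinite.symm A) (clean c A)) 0);
    let Linv : ((Fin n → ℕ) → κ) → Set (Fin n → κ) := fun c => {w : Fin n → κ | MvPolynomial.aeval (fun j : Fin n => (MvPolynomial.X (some j) : MvPolynomial (Option (Fin n)) κ) + MvPolynomial.C (w j) * MvPolynomial.X none) (cone c) = MvPolynomial.rename some (cone c) + MvPolynomial.C (MvPolynomial.eval w (cone c)) * (MvPolynomial.X none) ^ p};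
    MultP c → MultP (step i τ c) → Function.update τ i 1 ∈ Linv c := by
  intro p hp n hn κ _ _ _ c i τ clean bl ord dv tr step MultP cone Linv hc hstep
  have hsl := stub_slice stub_dict p hp n hn κ c i τ hc
  show MvPolynomial.aeval _ (cone c) = _
  refine stub_homogNear p hp n κ (cone c) i τ (nrd_isHomogeneous_coneSum p n (clean c)) ?_
  intro A hAi hpos hlt
  have hndvd : ¬ ∀ j, p ∣ A j := by
    intro hall
    obtain ⟨j, hj⟩ : ∃ j, A j ≠ 0 := by
      by_contra hnone
      push Not at hnone
      have : Finset.sum Finset.univ (fun j => A j) = 0 := Finset.sum_eq_zero (fun j _ => hnone j)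
      omega
    have hpj : p ≤ A j := Nat.le_of_dvd (Nat.pos_of_ne_zero hj) (hall j)
    have : A j ≤ Finset.sum Finset.univ (fun j => A j) :=
      Finset.single_le_sum (f := fun j => A j) (fun _ _ => Nat.zero_le _) (Finset.mem_univ j)
    omega
  have hA : step i τ c ⇑A = @ite κ (∀ j, p ∣ A j) (Classical.dec _) 0
      (MvPolynomial.coeff (Finsupp.equivFunOnFinite.symm ⇑A)
        (MvPolynomial.aeval (fun j : Fin n => if j = i then (1 : MvPolynomial (Fin n) κ) else
          MvPolynomial.X j + MvPolynomial.C (τ j)) (cone c))) := hsl (⇑A) hAi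
  rw [if_neg hndvd, Finsupp.equivFunOnFinite_symm_coe] at hA
  by_contra hne
  have h2 : clean (step i τ c) ⇑A ≠ 0 → p ≤ Finset.sum Finset.univ (fun j => A j) := hstep.2 (⇑A)
  have hcl : clean (step i τ c) ⇑A = step i τ c ⇑A := if_neg hndvd
  rw [hcl, hA] at h2
  have := h2 hne
  omega

/-- **Transversality of the next invariance space** (one blow-up; the refuters' key lemma
`L(G|_H) = L(G) ∩ H`): if `c` has multiplicity `p`, `v = e_i + Σ τ_j e_j ∈ Linv c` and `dL c = 1`, then
`Linv (step i τ c)` meets the new exceptional hyperplane `{w | w_i = 0}` only in `0`.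
[cite: CossartJannsenSaito2020, Thm. 3.14] -/
theorem nrd_transversal :
  ∀ p : ℕ, p.Prime → ∀ n : ℕ, 0 < n → ∀ (κ : Type) [Field κ] [CharP κ p] [PerfectField κ]
    (c : (Fin n → ℕ) → κ) (i : Fin n) (τ : Fin n → κ),
    let clean : ((Fin n → ℕ) → κ) → ((Fin n → ℕ) → κ) := fun c A => @ite κ (∀ j, p ∣ A j) (Classical.dec _) 0 (c A);
    let bl : Fin n → ((Fin n → ℕ) → κ) → ((Fin n → ℕ) → κ) := fun i c B => @ite κ (Finset.sum (Finset.univ.erase i) (fun j => B j) ≤ B i) (Classical.dec _) (c (Function.update B i (B i - Finset.sum (Finset.univ.erase i) (fun j => B j)))) 0;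
    let ord : ((Fin n → ℕ) → κ) → ℕ := fun c => sInf {m : ℕ | ∃ A, c A ≠ 0 ∧ m = Finset.sum Finset.univ (fun j => A j)};
    let dv : Fin n → ℕ → ((Fin n → ℕ) → κ) → ((Fin n → ℕ) → κ) := fun i s c B => c (Function.update B i (B i + s));
    let tr : Fin n → (Fin n → κ) → ℕ → ((Fin n → ℕ) → κ) → ((Fin n → ℕ) → κ) := fun i τ s c B => Finset.sum (Fintype.piFinset (fun _ : Fin n => Finset.range (B i + s + 1))) (fun D => @ite κ (D i = 0) (Classical.dec _) (c (B + D) * Finset.prod (Finset.univ.erase i) (fun j => ((Nat.choose (B j + D j) (B j) : ℕ) : κ) * τ j ^ (D j))) 0);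
    let step : Fin n → (Fin n → κ) → ((Fin n → ℕ) → κ) → ((Fin n → ℕ) → κ) := fun i τ c => clean (tr i τ (@ite ℕ (p ≤ ord (clean c)) (Classical.dec _) p 0) (dv i (@ite ℕ (p ≤ ord (clean c)) (Classical.dec _) p 0) (bl i (clean c))));
    let MultP : ((Fin n → ℕ) → κ) → Prop := fun c => (∃ A, clean c A ≠ 0) ∧ ∀ A, clean c A ≠ 0 → p ≤ Finset.sum Finset.univ (fun j => A j);
    let cone : ((Fin n → ℕ) → κ) → MvPolynomial (Fin n) κ := fun c => Finset.sum (Fintype.piFinset (fun _ : Fin n => Finset.range (p + 1))) (fun A => @ite (MvPolynomial (Fin n) κ) (Finset.sum Finset.univ (fun j => A j) = p) (Classical.dec _) (MvPolynomial.monomial (Finsupp.equivFunOnFinite.symm A) (clean c A)) 0);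
    let Linv : ((Fin n → ℕ) → κ) → Set (Fin n → κ) := fun c => {w : Fin n → κ | MvPolynomial.aeval (fun j : Fin n => (MvPolynomial.X (some j) : MvPolynomial (Option (Fin n)) κ) + MvPolynomial.C (w j) * MvPolynomial.X none) (cone c) = MvPolynomial.rename some (cone c) + MvPolynomial.C (MvPolynomial.eval w (cone c)) * (MvPolynomial.X none) ^ p};
    let dL : ((Fin n → ℕ) → κ) → ℕ := fun c => Module.finrank κ (Submodule.span κ (Linv c));
    MultP c → Function.update τ i 1 ∈ Linv c → dL c = 1 →
    ∀ w ∈ Linv (step i τ c), w i = 0 → w = 0 := by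
  intro p hp n hn κ _ _ _ c i τ clean bl ord dv tr step MultP cone Linv dL hc hv hdL w hw hwi
  have hsl := stub_slice stub_dict p hp n hn κ c i τ hc
  -- `w ∈ Linv c`
  have hwL : w ∈ Linv c := by
    show MvPolynomial.aeval _ (cone c) = _
    refine stub_homogTrans p hp n κ (cone c) (cone (step i τ c)) i τ w (nrd_isHomogeneous_coneSum p n (clean c))
      (nrd_isHomogeneous_coneSum p n (clean (step i τ c))) ?_ hwi hv ?_ hw
    · intro j
      show MvPolynomial.coeff _ (Finset.sum _ _) = 0
      rw [nrd_coeff_coneSum]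
      split_ifs with hs'
      · show @ite κ (∀ j', p ∣ (Finsupp.single j p) j') (Classical.dec _) 0 (c ⇑(Finsupp.single j p)) = 0
        rw [if_pos]
        intro j'
        by_cases hjj : j' = j
        · subst hjj; simp
        · simp [Ne.symm hjj]
      · rfl
    · intro A hAi hdeg
      show MvPolynomial.coeff A (Finset.sum _ _) = _
      rw [nrd_coeff_coneSum, if_pos hdeg]
      show @ite κ (∀ j, p ∣ A j) (Classical.dec _) 0 (step i τ c ⇑A) = _
      by_cases hall : ∀ j, p ∣ A j
      · rw [if_pos hall, if_pos hall]
      · have e : step i τ c ⇑A = @ite κ (∀ j, p ∣ A j) (Classical.dec _) 0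
            (MvPolynomial.coeff (Finsupp.equivFunOnFinite.symm ⇑A)
              (MvPolynomial.aeval (fun j : Fin n => if j = i then (1 : MvPolynomial (Fin n) κ) else
                MvPolynomial.X j + MvPolynomial.C (τ j)) (cone c))) := hsl (⇑A) hAi
        rw [if_neg hall, if_neg hall, e, if_neg hall, Finsupp.equivFunOnFinite_symm_coe]
  -- `dL c = 1`: the span is the line through `v`
  have hv0 : (⟨Function.update τ i 1, Submodule.subset_span hv⟩ : Submodule.span κ (Linv c)) ≠ 0 := by
    intro h
    have h' := congrArg (fun x : Submodule.span κ (Linv c) => (x : Fin n → κ) i) h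
    simp at h'
  obtain ⟨a, ha⟩ := (finrank_eq_one_iff_of_nonzero' _ hv0).mp hdL ⟨w, Submodule.subset_span hwL⟩
  have ha' : a • Function.update τ i 1 = w := congrArg Subtype.val ha
  have hai : a = 0 := by
    have := congrArg (fun x : Fin n → κ => x i) ha'
    simpa [hwi] using this
  rw [← ha', hai, zero_smul]

/-- **Narrow runs are free** (the birth line's `stub_narrowIsFree`, verbatim statement): along a run
all of whose states are isolated of multiplicity `p`, of cleaned order `p` and with `dL = 1`, every
centre is off the strict transform of the previous exceptional divisor:
`i (m+1) = i m ∨ t (m+1) (i m) ≠ 0`. [cite: CossartJannsenSaito2020, Cor. 6.37] -/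
theorem nrd_narrowIsFree :
  ∀ p : ℕ, p.Prime → ∀ n : ℕ, 0 < n → ∀ (κ : Type) [Field κ] [CharP κ p] [PerfectField κ]
    (c₀ : (Fin n → ℕ) → κ) (i : ℕ → Fin n) (t : ℕ → Fin n → κ),
    let clean : ((Fin n → ℕ) → κ) → ((Fin n → ℕ) → κ) := fun c A => @ite κ (∀ j, p ∣ A j) (Classical.dec _) 0 (c A);
    let bl : Fin n → ((Fin n → ℕ) → κ) → ((Fin n → ℕ) → κ) := fun i c B => @ite κ (Finset.sum (Finset.univ.erase i) (fun j => B j) ≤ B i) (Classical.dec _) (c (Function.update B i (B i - Finset.sum (Finset.univ.erase i) (fun j => B j)))) 0;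
    let ord : ((Fin n → ℕ) → κ) → ℕ := fun c => sInf {m : ℕ | ∃ A, c A ≠ 0 ∧ m = Finset.sum Finset.univ (fun j => A j)};
    let dv : Fin n → ℕ → ((Fin n → ℕ) → κ) → ((Fin n → ℕ) → κ) := fun i s c B => c (Function.update B i (B i + s));
    let tr : Fin n → (Fin n → κ) → ℕ → ((Fin n → ℕ) → κ) → ((Fin n → ℕ) → κ) := fun i τ s c B => Finset.sum (Fintype.piFinset (fun _ : Fin n => Finset.range (B i + s + 1))) (fun D => @ite κ (D i = 0) (Classical.dec _) (c (B + D) * Finset.prod (Finset.univ.erase i) (fun j => ((Nat.choose (B j + D j) (B j) : ℕ) : κ) * τ j ^ (D j))) 0);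
    let step : Fin n → (Fin n → κ) → ((Fin n → ℕ) → κ) → ((Fin n → ℕ) → κ) := fun i τ c => clean (tr i τ (@ite ℕ (p ≤ ord (clean c)) (Classical.dec _) p 0) (dv i (@ite ℕ (p ≤ ord (clean c)) (Classical.dec _) p 0) (bl i (clean c))));
    let run : ((Fin n → ℕ) → κ) → (ℕ → Fin n) → (ℕ → Fin n → κ) → ℕ → ((Fin n → ℕ) → κ) := fun c₀ i t m => @Nat.rec (fun _ => (Fin n → ℕ) → κ) c₀ (fun m c => step (i m) (t m) c) m;
    let ser : ((Fin n → ℕ) → κ) → MvPowerSeries (Fin n) κ := fun c => show MvPowerSeries (Fin n) κ from fun A : Fin n →₀ ℕ => clean c ⇑A;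
    let pd : Fin n → MvPowerSeries (Fin n) κ → MvPowerSeries (Fin n) κ := fun i f => show MvPowerSeries (Fin n) κ from fun A : Fin n →₀ ℕ => ((A i + 1 : ℕ) : κ) * f (A + Finsupp.single i 1);
    let jac : ((Fin n → ℕ) → κ) → Ideal (MvPowerSeries (Fin n) κ) := fun c => Ideal.span (Set.range (fun i => pd i (ser c)));
    let Isol : ((Fin n → ℕ) → κ) → Prop := fun c => Module.Finite κ (MvPowerSeries (Fin n) κ ⧸ jac c);
    let MultP : ((Fin n → ℕ) → κ) → Prop := fun c => (∃ A, clean c A ≠ 0) ∧ ∀ A, clean c A ≠ 0 → p ≤ Finset.sum Finset.univ (fun j => A j);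
    let OrdP : ((Fin n → ℕ) → κ) → Prop := fun c => ∃ A, clean c A ≠ 0 ∧ Finset.sum Finset.univ (fun j => A j) = p;
    let cone : ((Fin n → ℕ) → κ) → MvPolynomial (Fin n) κ := fun c => Finset.sum (Fintype.piFinset (fun _ : Fin n => Finset.range (p + 1))) (fun A => @ite (MvPolynomial (Fin n) κ) (Finset.sum Finset.univ (fun j => A j) = p) (Classical.dec _) (MvPolynomial.monomial (Finsupp.equivFunOnFinite.symm A) (clean c A)) 0);
    let Linv : ((Fin n → ℕ) → κ) → Set (Fin n → κ) := fun c => {w : Fin n → κ | MvPolynomial.aeval (fun j : Fin n => (MvPolynomial.X (some j) : MvPolynomial (Option (Fin n)) κ) + MvPolynomial.C (w j) * MvPolynomial.X none) (cone c) = MvPolynomial.rename some (cone c) + MvPolynomial.C (MvPolynomial.eval w (cone c)) * (MvPolynomial.X none) ^ p};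
    let dL : ((Fin n → ℕ) → κ) → ℕ := fun c => Module.finrank κ (Submodule.span κ (Linv c));
    (∀ m, Isol (run c₀ i t m) ∧ MultP (run c₀ i t m)) →
    (∀ m, OrdP (run c₀ i t m) ∧ dL (run c₀ i t m) = 1) →
    ∀ m, i (m + 1) = i m ∨ t (m + 1) (i m) ≠ 0 := by
  intro p hp n hn κ _ _ _ c₀ i t clean bl ord dv tr step run ser pd jac Isol MultP OrdP cone Linv dL
    hall hnar m
  by_contra hcon
  have hne : i (m + 1) ≠ i m := fun h => hcon (Or.inl h)
  have ht : t (m + 1) (i m) = 0 := by_contra fun h => hcon (Or.inr h)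
  have hv0 : Function.update (t m) (i m) 1 ∈ Linv (run c₀ i t m) :=
    nrd_nearInvariant p hp n hn κ (run c₀ i t m) (i m) (t m) (hall m).2 (hall (m + 1)).2
  have hv1 : Function.update (t (m + 1)) (i (m + 1)) 1 ∈ Linv (run c₀ i t (m + 1)) :=
    nrd_nearInvariant p hp n hn κ (run c₀ i t (m + 1)) (i (m + 1)) (t (m + 1)) (hall (m + 1)).2 (hall (m + 1 + 1)).2
  have hw : Function.update (t (m + 1)) (i (m + 1)) 1 = 0 :=
    nrd_transversal p hp n hn κ (run c₀ i t m) (i m) (t m) (hall m).2 hv0 (hnar m).2 _ hv1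
      (by rw [Function.update_of_ne hne.symm]; exact ht)
  have h1 : Function.update (t (m + 1)) (i (m + 1)) (1 : κ) (i (m + 1)) = 0 := by
    rw [hw]; rfl
  simp at h1

/-- **The crux `NarrowRunsDie` of route `WildCones`** (item stmt-ResolutionOfSingularities-16882):
narrow isolated multiplicity-`p` runs of the point-blow-up dynamics of a height-one atom do not exist.
Proof: the run is free (`nrd_narrowIsFree`); the Frobenius coset of the pulled-back start series
(`stub_coset`, through the dictionary `stub_dict`) and the derivation lift (`stub_partialsDivisible`)
give `π_m Φ_m(∂_l a₀) ∈ (π_m^p)` for all `m, l`; the free endgame (`stub_freeEndgame`) contradicts the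
isolatedness of the start state. [cite: CossartJannsenSaito2020, Cor. 6.37; HauserPerlega2019, §1] -/
theorem NarrowRunsDie_proof : NarrowRunsDie := by
  intro p hp _ n hn κ _ _ _ c₀ i t clean bl ord dv tr step run ser pd jac Isol MultP OrdP cone Linv dL
    hall hnar
  have hn0 : 0 < n := by omega
  have hfree : ∀ m, i (m + 1) = i m ∨ t (m + 1) (i m) ≠ 0 :=
    nrd_narrowIsFree p hp n hn0 κ c₀ i t hall hnar
  refine stub_freeEndgame p hp n hn0 κ c₀ i t (hall 0).1 hfree ?_
  intro m l
  obtain ⟨b, hb⟩ := stub_coset stub_dict p hp n hn0 κ c₀ i t (fun m => (hall m).2) m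
  exact stub_partialsDivisible p hp n hn0 κ i t m l _ _ b hb

end Summit.ResolutionOfSingularities.ResolutionOfSingularities.Theorems

end
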